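import Mathlib
import Summits.Ventures.PercRepro2.Defs
import Summits.Ventures.PercRepro2.Independence
import Summits.Ventures.PercRepro2.Harris
import Summits.Ventures.PercRepro2.Graph
import Summits.Ventures.PercRepro2.Exploration
import Summits.Ventures.PercRepro2.Events
import Summits.Ventures.PercRepro2.FourFunctions
import Summits.Ventures.PercRepro2.Induced
import Summits.Ventures.PercRepro2.Frontier
import Summits.Ventures.PercRepro2.ObsIndependence
import Summits.Ventures.PercRepro2.BHK
import Summits.Ventures.PercRepro2.BHKEvents
import Summits.Ventures.PercRepro2.VdBKahn
import Summits.Ventures.PercRepro2.BHKAvoid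
import Summits.Ventures.PercRepro2.R2PrimeThreeReduction
import Summits.Ventures.PercRepro2.YBridge
import Summits.Ventures.PercRepro2.Yu1Functionals
import Summits.Ventures.PercRepro2.Yu1Events
import Summits.Ventures.PercRepro2.Yu1
import Summits.Ventures.PercRepro2.LBSplit
import Summits.Ventures.PercRepro2.YDelta
import Summits.Ventures.PercRepro2.YDeltaTools
import Summits.Ventures.PercRepro2.SD
import Summits.Ventures.PercRepro2.Lambda
import Summits.Ventures.PercRepro2.LambdaTau
import Summits.Ventures.PercRepro2.LambdaSlack
import Summits.Ventures.PercRepro2.ZDelta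
import Summits.Ventures.PercRepro2.ZLine

/-!
# The tie statement, deterministic weights and the segment identity (blind cell PercRepro2,
typer-1; mine-1 `MINE-1.md` §19.3 — the ingredients of the line induction `ZLineInduction.lean`)

* **`Tie`** / `Tie_all`: the tie statement (T) — `ZDelta` at every instance with `P(a₁ ↔ b) = P(a₂ ↔ b)`;
* deterministic weights: `detConfig`, `weight_det`, `prob_det` (`P = 1_A(σ_p)` when every
  `p_e ∈ {0, 1}`), and the base case **`Zq_nonneg_of_det`** (`Z ≥ 0` at `0/1` weights under the
  labelling: on `PD` the events `T`, `T′` are impossible, `b ∈ C₁` contradicts the labelling, and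
  `Z = 1{o ∈ C₂, b ∈ C₂}`);
* **`Zq_mix`**: the quadratic identity along the segment `[v(α), v(β)]` of an edge line,
  `Z(p[e ↦ (1 − t) α + t β]) = (1 − t)² Z(p[e ↦ α]) + t (1 − t) · 2B(v(α), v(β)) + t² Z(p[e ↦ β])`;
* `fracCount` and `fracCount_update_lt`: pinning a fractional edge lowers the number of fractional
  edges.
-/

namespace Summit.Ventures.PercRepro2

open UnionCluster

namespace ZLine

open Classical

/-! ## The tie statement -/

section TieDef

variable {V : Type*} {E : Type*} [Fintype E] [DecidableEq E] {R : Type*} [Field R]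
  [LinearOrder R] [IsStrictOrderedRing R]

/-- **(T), the tie statement**: `ZDelta` at a labelling tie `P(a₁ ↔ b) = P(a₂ ↔ b)`. -/
def Tie (p : E → R) (ends : E → Sym2 V) (o a₁ a₂ a₃ b : V) : Prop :=
  labelGap p ends a₁ a₂ b = 0 → ZDelta p ends o a₁ a₂ a₃ b

end TieDef

section TieClosure

variable (R : Type*) [Field R] [LinearOrder R] [IsStrictOrderedRing R]

/-- **(T) for every finite graph** (census: 0 negatives at 17,422,428 exact ties at n = 7). -/
def Tie_all : Prop :=
  ∀ (V E : Type) [Fintype V] [DecidableEq V] [Fintype E] [DecidableEq E]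
    (ends : E → Sym2 V) (p : E → R), IsProbVec p →
    ∀ o a₁ a₂ a₃ b : V, a₁ ≠ a₂ → a₁ ≠ a₃ → a₂ ≠ a₃ → o ≠ a₁ → o ≠ a₂ → o ≠ a₃ → o ≠ b →
      b ≠ a₁ → b ≠ a₂ → b ≠ a₃ → Tie p ends o a₁ a₂ a₃ b

end TieClosure

/-! ## Deterministic weights -/

section Det

variable {E : Type*} [Fintype E] [DecidableEq E] {R : Type*} [Field R]

/-- The configuration selected by a `0/1` weight vector. -/
noncomputable def detConfig (p : E → R) : Config E := fun e => decide (p e = 1)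

omit [DecidableEq E] in
/-- At `0/1` weights the weight is the point mass at `detConfig p`. -/
lemma weight_det (p : E → R) (hp : ∀ e, p e = 0 ∨ p e = 1) (ω : Config E) :
    weight p ω = if ω = detConfig p then 1 else 0 := by
  unfold weight
  split_ifs with h
  · subst h
    refine Finset.prod_eq_one fun e _ => ?_
    rcases hp e with h0 | h1
    · have : detConfig p e = false := by
        simp [detConfig, h0]
      rw [this, h0]
      simp [edgeFactor]
    · have : detConfig p e = true := by simp [detConfig, h1]
      rw [this, h1]
      simp [edgeFactor]
  · obtain ⟨e, he⟩ : ∃ e, ω e ≠ detConfig p e := by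
      by_contra hall
      push Not at hall
      exact h (funext hall)
    refine Finset.prod_eq_zero (Finset.mem_univ e) ?_
    rcases hp e with h0 | h1
    · have hd : detConfig p e = false := by simp [detConfig, h0]
      rw [hd] at he
      have : ω e = true := by
        cases hω : ω e
        · exact absurd hω he
        · rfl
      rw [this, h0]
      simp [edgeFactor]
    · have hd : detConfig p e = true := by simp [detConfig, h1]
      rw [hd] at he
      have : ω e = false := by
        cases hω : ω e
        · rfl
        · exact absurd hω he
      rw [this, h1]
      simp [edgeFactor]

/-- At `0/1` weights every probability is the indicator at `detConfig p`. -/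
lemma prob_det (p : E → R) (hp : ∀ e, p e = 0 ∨ p e = 1) (A : Set (Config E)) :
    prob p A = A.indicator 1 (detConfig p) := by
  unfold prob
  rw [Finset.sum_eq_single (detConfig p)]
  · by_cases hA : detConfig p ∈ A
    · rw [Set.indicator_of_mem hA, Set.indicator_of_mem hA, weight_det p hp, if_pos rfl]
      rfl
    · rw [Set.indicator_of_notMem hA, Set.indicator_of_notMem hA]
  · intro ω _ hω
    by_cases hA : ω ∈ A
    · rw [Set.indicator_of_mem hA, weight_det p hp, if_neg hω]
    · rw [Set.indicator_of_notMem hA]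
  · intro h
    exact absurd (Finset.mem_univ _) h

end Det

section Base

variable {V : Type*} {E : Type*} [Fintype E] [DecidableEq E] {R : Type*} [Field R]
  [LinearOrder R] [IsStrictOrderedRing R]

/-- **The base case**: at `0/1` weights, under the labelling, `Z ≥ 0`. -/
theorem Zq_nonneg_of_det (p : E → R) (hp : ∀ e, p e = 0 ∨ p e = 1) (ends : E → Sym2 V)
    (o a₁ a₂ a₃ b : V) (hlab : 0 ≤ labelGap p ends a₁ a₂ b) :
    0 ≤ Zq p ends o a₁ a₂ a₃ b := by
  rw [Zq_eq_slack]
  unfold labelGap at hlab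
  unfold massM2 deltaT deltaL deltaH
  simp only [prob_det p hp, indicator_inter_one] at hlab ⊢
  set σ := detConfig p
  by_cases hPD : σ ∈ PDEvent ends a₁ a₂ a₃
  · have hPD' := hPD
    simp only [PDEvent, Dtilde, inU, Set.mem_inter_iff, Set.mem_compl_iff, Set.mem_union,
      mem_connEvent, not_or] at hPD'
    obtain ⟨h12, h31, h32⟩ := hPD'
    have hT : σ ∉ TEvent ends a₁ a₂ a₃ := by
      simp only [TEvent, Set.mem_inter_iff, Set.mem_compl_iff, mem_connEvent, not_and]
      intro _ h23
      exact h32 (conn_symm h23)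
    have hT' : σ ∉ TEvent ends a₂ a₁ a₃ := by
      simp only [TEvent, Set.mem_inter_iff, Set.mem_compl_iff, mem_connEvent, not_and]
      intro _ h13
      exact h31 (conn_symm h13)
    have hbL : σ ∉ connEvent ends a₁ b := by
      intro h1b
      have h2b : σ ∈ connEvent ends a₂ b := by
        by_contra h2b
        rw [Set.indicator_of_mem h1b, Set.indicator_of_notMem h2b] at hlab
        simp only [Pi.one_apply] at hlab
        linarith
      exact h12 (conn_trans h1b (conn_symm h2b))
    simp only [Set.indicator_of_mem hPD, Set.indicator_of_notMem hT, Set.indicator_of_notMem hT',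
      Set.indicator_of_notMem hbL, Pi.one_apply]
    have h1 : 0 ≤ (connEvent ends a₂ o).indicator (1 : Config E → R) σ :=
      Set.indicator_apply_nonneg fun _ => zero_le_one
    have h2 : 0 ≤ (connEvent ends a₂ b).indicator (1 : Config E → R) σ :=
      Set.indicator_apply_nonneg fun _ => zero_le_one
    nlinarith [mul_nonneg h1 h2]
  · simp [Set.indicator_of_notMem hPD]

end Base

/-! ## The segment identity and the fractional-edge count -/

section Segment

variable {V : Type*} {E : Type*} [Fintype E] [DecidableEq E] {R : Type*} [Field R]

/-- **The quadratic identity along a segment of an edge line**: for `ε = (1 − t) α + t β`,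
`Z(p[e ↦ ε]) = (1 − t)² Z(p[e ↦ α]) + t (1 − t) · 2B(v(α), v(β)) + t² Z(p[e ↦ β])`. -/
theorem Zq_mix (p : E → R) (ends : E → Sym2 V) (o a₁ a₂ a₃ b : V) (e : E) (α β t : R) :
    Zq (Function.update p e ((1 - t) * α + t * β)) ends o a₁ a₂ a₃ b =
      (1 - t) ^ 2 * Zq (Function.update p e α) ends o a₁ a₂ a₃ b +
        t * (1 - t) * polar2 (Function.update p e α) (Function.update p e β) ends o a₁ a₂ a₃ b +
        t ^ 2 * Zq (Function.update p e β) ends o a₁ a₂ a₃ b := by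
  unfold Zq polar2
  rw [vD_at p ends a₁ a₂ a₃ e ((1 - t) * α + t * β), vDo_at p ends o a₁ a₂ a₃ e ((1 - t) * α + t * β),
    vW_at p ends a₁ a₂ a₃ b e ((1 - t) * α + t * β), vX_at p ends o a₁ a₂ a₃ b e ((1 - t) * α + t * β),
    vD_at p ends a₁ a₂ a₃ e α, vDo_at p ends o a₁ a₂ a₃ e α, vW_at p ends a₁ a₂ a₃ b e α,
    vX_at p ends o a₁ a₂ a₃ b e α, vD_at p ends a₁ a₂ a₃ e β, vDo_at p ends o a₁ a₂ a₃ e β,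
    vW_at p ends a₁ a₂ a₃ b e β, vX_at p ends o a₁ a₂ a₃ b e β]
  ring

/-- The number of fractional edges. -/
noncomputable def fracCount (p : E → R) : ℕ :=
  (Finset.univ.filter fun e => p e ≠ 0 ∧ p e ≠ 1).card

/-- Pinning a fractional edge to `0` or `1` lowers the number of fractional edges. -/
lemma fracCount_update_lt (p : E → R) {e : E} (he : p e ≠ 0 ∧ p e ≠ 1) {x : R}
    (hx : x = 0 ∨ x = 1) : fracCount (Function.update p e x) < fracCount p := by
  unfold fracCount
  have hset : (Finset.univ.filter fun e' => Function.update p e x e' ≠ 0 ∧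
      Function.update p e x e' ≠ 1) = (Finset.univ.filter fun e' => p e' ≠ 0 ∧ p e' ≠ 1).erase e := by
    ext e'
    simp only [Finset.mem_filter, Finset.mem_univ, true_and, Finset.mem_erase]
    by_cases h : e' = e
    · subst h
      rw [Function.update_self]
      constructor
      · rintro ⟨hx0, hx1⟩
        rcases hx with rfl | rfl
        · exact absurd rfl hx0
        · exact absurd rfl hx1
      · rintro ⟨hne, _⟩
        exact absurd rfl hne
    · rw [Function.update_of_ne h]
      constructor
      · intro h'
        exact ⟨h, h'⟩
      · intro h'
        exact h'.2
  rw [hset]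
  exact Finset.card_erase_lt_of_mem (Finset.mem_filter.2 ⟨Finset.mem_univ e, he⟩)

end Segment

end ZLine

end Summit.Ventures.PercRepro2
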